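import Literature.AnabelianGeometry.AbsoluteAnabelian.AbsTopIProp23iGFGSurfaceModel
import HarnessLib

/-!
# [AbsTopI] Prop 2.3 (i) at the GFG construction of Def 2.1 (i): the outer-faithfulness ENGINE

S. Mochizuki, *Topics in Absolute Anabelian Geometry I: Generalities* (2012) [AbsTopI] (lit key
`paper:url-11ac98ba15fc`), Def 2.1 (i) p. 17 ("`π₁(X_k̄) ↠ Δ_X` an almost pro-`Σ`-maximal quotient …
`Ker(Δ_X → Gal(Y/X))` may be identified with the maximal pro-`Σ` quotient of `Ker(π₁(X_k̄) → Gal(Y/X))`"),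
Prop 2.3 (i) p. 19 ("`Δ` is slim and elastic").

THE MODEL (as in `AbsTopIProp23iGFGSurfaceModel.lean`, abc-iut-w6-d030, PROPER case): `P` profinite, `j : Γ → P`
a pro-`Σ′` completion of a discrete group `Γ` (`Σ ⊆ Σ′`), `U ⊴ P` open normal, `π : P ↠ D` continuous with
`ker π ≤ U` whose restriction `U ↠ π(U)` PRESENTS THE MAXIMAL PRO-`Σ` QUOTIENT of `U`
(`PSCDatum.IsMaxProSigmaQuotient`).

THIS PROOF-ONLY FILE (abc-iut-w6-d071, the AFFINE writer; no definition, no named fact) isolates the ENGINE of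
(T1) `Z_D(π(U)) = 1` — abc-iut-w6-d030's proof for closed surface groups uses the surface structure ONLY through

* (SLIM) every pro-`Σ` completion of `j⁻¹V`, `V ⊇ U` open, is slim, and
* (RIGID) if a profinite `Q` is a pro-`Σ` completion of `j⁻¹V` (`V ⊇ U` open) through `φ` AND of `j⁻¹U` through
  the restriction `φ|`, then `j⁻¹V ≤ j⁻¹U` (for surface / free groups: the free pro-`ℓ` rank of a completion of an
  index-`d` subgroup grows strictly with `d`),

and `centralizer_map_eq_bot_of_slim_of_rigid` proves (T1) from exactly these two hypotheses (verbatim the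
argument of p440186: `δ ∈ Z_D(π(U))` has finite order; `W := π(U)·⟨δ⟩`, `U′ := π⁻¹W`; the maximal pro-`Σ`
quotient `Q″` of `U′` is a pro-`Σ` completion of `j⁻¹U′`, slim; elements of `U′` over `⟨δ⟩` die in `Q″`;
maximality against `U′ → W/⟨δ⟩` shows `U ↠ Q″` ALSO presents the maximal pro-`Σ` quotient of `U`, so `Q″` is a
pro-`Σ` completion of `j⁻¹U` too; (RIGID) gives `U′ = U`, `δ ∈ π(U)`, `δ = 1`).  The affine case
(`AbsTopIProp23iGFGAffineModel.lean`) and the proper case are then short instantiations.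

HONEST SCOPE: plain profinite group theory at the Def 2.1 (i) construction; model-level; OUR kernel check;
nothing here bears on [IUTchIII] Cor. 3.12; no side is taken.
-/

noncomputable section

open Topology

universe u

namespace Literature.AnabelianGeometry.AbsoluteAnabelian

namespace GFGSurfaceModel

open Literature.AlgebraicGeometry.Frobenioids (IsSlimGroup)
open Literature.AnabelianGeometry.Anabelioids (IsSigmaInteger)
open Literature.AnabelianGeometry.SemiGraphs (IsProSigma)
open Literature.AnabelianGeometry.SemiGraphs.PSCDatum (IsMaxProSigmaQuotient exists_isMaxProSigmaQuotient)
open Literature.AnabelianGeometry.SemiGraphs.SemiGraphOfAnabelioids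
open Literature.AnabelianGeometry.SemiGraphs.SemiGraphOfAnabelioids.IsProSigmaCompletion
open Literature.GroupTheory.ProfiniteSubquotients

variable {Sigma Sigma' : Set ℕ} {Γ : Type*} [Group Γ]
  {P : Type u} [Group P] [TopologicalSpace P] [IsTopologicalGroup P] [CompactSpace P]
  [TotallyDisconnectedSpace P]
  {D : Type u} [Group D] [TopologicalSpace D] [IsTopologicalGroup D] [CompactSpace D] [T2Space D]
  [TotallyDisconnectedSpace D]
  {j : Γ →* P} {π : P →* D} {U : Subgroup P}

/-- **(T1) ENGINE — `Z_D(U^Σ) = 1` at the GFG construction of [AbsTopI] Def 2.1 (i) from (SLIM) + (RIGID).**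
`P` profinite, `j : Γ → P` a pro-`Σ′` completion, `U ⊴ P` open, `π : P ↠ D` continuous with `ker π ≤ U` and
`U ↠ π(U)` presenting the maximal pro-`Σ` quotient of `U` (`Σ ⊆ Σ′`).  IF (SLIM) every profinite pro-`Σ`
completion of `j⁻¹V` for `V ⊇ U` open is slim, AND (RIGID) a profinite group that is a pro-`Σ` completion of
`j⁻¹V` through `φ` and of `j⁻¹U` through `φ|_{j⁻¹U}` forces `j⁻¹V ≤ j⁻¹U`, THEN the centraliser of `π(U)` in
`D` is trivial — the deck group `D/π(U) = Gal(Y/X)` acts outer-faithfully on `U^Σ`.  (Proof = abc-iut-w6-d030's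
p440186 `centralizer_map_eq_bot` with the two surface-specific inputs abstracted.)
[cite: MochizukiAbsTopI2012, Prop 2.3 (i) p.19] -/
theorem centralizer_map_eq_bot_of_slim_of_rigid (hSS : Sigma ⊆ Sigma')
    (hj : IsProSigmaCompletion Sigma' j) [hUn : U.Normal] (hUo : IsOpen (U : Set P))
    (hπc : Continuous π) (hπs : Function.Surjective π) (hker : π.ker ≤ U)
    (hmax : IsMaxProSigmaQuotient Sigma (π.subgroupMap U))
    (hslim : ∀ (V : Subgroup P), IsOpen (V : Set P) → U ≤ V →
      ∀ {Q : Type u} [Group Q] [TopologicalSpace Q] [IsTopologicalGroup Q] [CompactSpace Q] [T2Space Q]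
        [TotallyDisconnectedSpace Q] (φ : V.comap j →* Q), IsProSigmaCompletion Sigma φ → IsSlimGroup Q)
    (hrigid : ∀ (V : Subgroup P), IsOpen (V : Set P) → (hUV : U ≤ V) →
      ∀ {Q : Type u} [Group Q] [TopologicalSpace Q] [IsTopologicalGroup Q] [CompactSpace Q] [T2Space Q]
        [TotallyDisconnectedSpace Q] (φ : V.comap j →* Q), IsProSigmaCompletion Sigma φ →
        IsProSigmaCompletion Sigma (φ.comp (Subgroup.inclusion (Subgroup.comap_mono hUV))) →
        V.comap j ≤ U.comap j) :
    Subgroup.centralizer ((U.map π : Subgroup D) : Set D) = ⊥ := by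
  classical
  -- the open normal subgroup `Ū = π(U)` and its presentation as a pro-`Σ` completion of `j⁻¹U`
  set Ubar : Subgroup D := U.map π with hUbar
  haveI hUbarn : Ubar.Normal := hUn.map π hπs
  have hUbarc : IsClosed (Ubar : Set D) := isClosed_map hUo hπc
  have hUbaro : IsOpen (Ubar : Set D) := isOpen_map hUo hπc hπs hker
  haveI : CompactSpace U := compactSpace_of_isOpen hUo
  haveI : CompactSpace Ubar := compactSpace_of_isClosed hUbarc
  haveI : Finite (P ⧸ U) := Subgroup.quotient_finite_of_isOpen U hUo
  haveI : U.FiniteIndex := Subgroup.finiteIndex_of_finite_quotient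
  haveI : (U.comap j).FiniteIndex := finiteIndex_comap hj U hUo
  have hidxU : (U.comap j).index = U.index := index_comap_of_isOpen hj U hUo
  have hιU := isProSigmaCompletion_map hSS hj hUo hπc hmax
  have hslimU : IsSlimGroup Ubar := hslim U hUo le_rfl _ hιU
  -- central elements of the slim group `Ū` are trivial
  have hcentral : ∀ d ∈ Ubar, (∀ h ∈ Ubar, h * d = d * h) → d = 1 := by
    intro d hd hcomm
    have hmem : (⟨d, hd⟩ : Ubar) ∈ Subgroup.centralizer ((⊤ : Subgroup Ubar) : Set Ubar) := by
      rw [Subgroup.mem_centralizer_iff]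
      intro h _
      exact Subtype.ext (hcomm h h.2)
    rw [centralizer_top_eq_bot_of_isSlimGroup hslimU, Subgroup.mem_bot] at hmem
    exact congrArg Subtype.val hmem
  rw [eq_bot_iff]
  intro δ hδ
  rw [Subgroup.mem_bot]
  rw [Subgroup.mem_centralizer_iff] at hδ
  by_contra hδ1
  have hδU : δ ∉ Ubar := fun h => hδ1 (hcentral δ h hδ)
  -- `δ` commutes with `Ū` and hence its powers do; `δ` has finite order
  have hpowU : ∀ k : ℤ, ∀ h ∈ Ubar, h * δ ^ k = δ ^ k * h := fun k h hh =>
    ((Commute.symm (hδ h hh) : Commute δ h).symm.zpow_right k).eq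
  have hδn : δ ^ Ubar.index = 1 := by
    refine hcentral _ (Ubar.pow_index_mem δ) fun h hh => ?_
    have := hpowU (Ubar.index : ℤ) h hh
    simpa only [zpow_natCast] using this
  haveI : Ubar.FiniteIndex :=
    ⟨by rw [hUbar, Subgroup.index_map_eq _ hπs hker]; exact Subgroup.FiniteIndex.index_ne_zero⟩
  have hδfin : IsOfFinOrder δ :=
    isOfFinOrder_iff_pow_eq_one.mpr ⟨Ubar.index, Nat.pos_of_ne_zero Subgroup.FiniteIndex.index_ne_zero, hδn⟩
  -- the finite cyclic group `C = ⟨δ⟩`, central in the open subgroup `W = Ū·C`, meeting `Ū` trivially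
  set C : Subgroup D := Subgroup.zpowers δ with hC
  have hCc : IsClosed (C : Set D) := hδfin.finite_zpowers.isClosed
  have hCU : ∀ c ∈ C, c ∈ Ubar → c = 1 := by
    intro c hc hcU
    obtain ⟨k, rfl⟩ := Subgroup.mem_zpowers_iff.mp hc
    exact hcentral _ hcU (hpowU k)
  set W : Subgroup D := Ubar ⊔ C with hW
  have hWo : IsOpen (W : Set D) := Subgroup.isOpen_mono le_sup_left hUbaro
  have hδW : δ ∈ W := Subgroup.mem_sup_right (Subgroup.mem_zpowers δ)
  have hWdec : ∀ w ∈ W, ∃ a ∈ Ubar, ∃ c ∈ C, a * c = w := fun w hw =>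
    Subgroup.mem_sup_of_normal_left.mp hw
  have hWcomm : ∀ w ∈ W, ∀ c ∈ C, w * c = c * w := by
    intro w hw c hc
    obtain ⟨a, ha, c', hc', rfl⟩ := hWdec w hw
    obtain ⟨k, rfl⟩ := Subgroup.mem_zpowers_iff.mp hc
    obtain ⟨k', rfl⟩ := Subgroup.mem_zpowers_iff.mp hc'
    rw [mul_assoc, ← zpow_add, add_comm, zpow_add, ← mul_assoc, hpowU k a ha, mul_assoc]
  -- the open subgroup `U′ = π⁻¹ W ⊇ U` of `P`
  set U' : Subgroup P := W.comap π with hU'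
  have hU'o : IsOpen (U' : Set P) := hWo.preimage hπc
  have hUU' : U ≤ U' := fun u hu => Subgroup.mem_comap.mpr (Subgroup.mem_sup_left (Subgroup.mem_map_of_mem π hu))
  haveI : CompactSpace U' := compactSpace_of_isOpen hU'o
  haveI : (U'.comap j).FiniteIndex := finiteIndex_comap hj U' hU'o
  have hidxU' : (U'.comap j).index = U'.index := index_comap_of_isOpen hj U' hU'o
  -- the maximal pro-`Σ` quotient `f″ : U′ ↠ Q″`, a pro-`Σ` completion of `j⁻¹U′`, hence slim by (SLIM)
  obtain ⟨K'', hK''n, hK''c, hf''⟩ := exists_isMaxProSigmaQuotient Sigma (P := U')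
  haveI := hK''n
  haveI : IsClosed ((K'' : Subgroup U') : Set U') := hK''c
  haveI : TotallyDisconnectedSpace (U' ⧸ K'') := totallyDisconnectedSpace_quotient K'' hK''c
  set f'' : U' →* U' ⧸ K'' := QuotientGroup.mk' K'' with hf''def
  have hι'' : IsProSigmaCompletion Sigma (f''.comp (j.subgroupComap U')) :=
    comp_isMaxProSigmaQuotient hSS (hj.restrict U' hU'o) hf''
  have hslimQ : IsSlimGroup (U' ⧸ K'') := hslim U' hU'o hUU' _ hι''
  have hZQ := centralizer_top_eq_bot_of_isSlimGroup hslimQ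
  -- `ker π`, seen in `U`, is the kernel of the presentation `U ↠ Ū`; it dies in `Q″`
  have hkerU : ∀ {z : P} (hz : π z = 1), ∃ hzU : z ∈ U, (π.subgroupMap U) ⟨z, hzU⟩ = 1 := by
    intro z hz
    have hzU : z ∈ U := hker (by rw [MonoidHom.mem_ker]; exact hz)
    exact ⟨hzU, Subtype.ext (by simp [hz])⟩
  have hkerQ : ∀ {z : P} (hz : π z = 1), ∃ hzU' : z ∈ U', f'' ⟨z, hzU'⟩ = 1 := by
    intro z hz
    obtain ⟨hzU, h1⟩ := hkerU hz
    exact ⟨hUU' hzU, map_eq_one_of_isMaxProSigmaQuotient_of_le hUU' hmax hf'' hzU h1⟩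
  -- CLAIM B: an element of `U′` whose image lies in `C` (so is central in `W`) dies in `Q″`
  have hB : ∀ (z : P) (hz : z ∈ U'), π z ∈ C → f'' ⟨z, hz⟩ = 1 := by
    intro z hz hzC
    have hcen : f'' ⟨z, hz⟩ ∈ Subgroup.centralizer ((⊤ : Subgroup (U' ⧸ K'')) : Set (U' ⧸ K'')) := by
      rw [Subgroup.mem_centralizer_iff]
      intro q _
      obtain ⟨⟨y, hy⟩, rfl⟩ := QuotientGroup.mk'_surjective K'' q
      -- the commutator `z y z⁻¹ y⁻¹` dies under `π`, hence under `f″`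
      have hπ1 : π (z * y * z⁻¹ * y⁻¹) = 1 := by
        have hc := hWcomm (π y) (Subgroup.mem_comap.mp hy) (π z) hzC
        simp only [map_mul, map_inv]
        rw [← hc]; group
      obtain ⟨hcU', hc1⟩ := hkerQ hπ1
      have hprod : (⟨z * y * z⁻¹ * y⁻¹, hcU'⟩ : U') = ⟨z, hz⟩ * ⟨y, hy⟩ * ⟨z, hz⟩⁻¹ * ⟨y, hy⟩⁻¹ := rfl
      rw [hprod, map_mul, map_mul, map_mul, map_inv, map_inv] at hc1
      have h1 : f'' ⟨z, hz⟩ * f'' ⟨y, hy⟩ * (f'' ⟨z, hz⟩)⁻¹ = f'' ⟨y, hy⟩ := mul_inv_eq_one.mp hc1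
      have h2 : f'' ⟨z, hz⟩ * f'' ⟨y, hy⟩ = f'' ⟨y, hy⟩ * f'' ⟨z, hz⟩ := mul_inv_eq_iff_eq_mul.mp h1
      exact h2.symm
    rw [hZQ, Subgroup.mem_bot] at hcen
    exact hcen
  -- the quotient `R = W/C`, a profinite pro-`Σ` group (an image of `Ū`)
  have hCW : C ≤ W := le_sup_right
  haveI hCWn : (C.subgroupOf W).Normal := by
    refine ⟨fun c hc w => ?_⟩
    rw [Subgroup.mem_subgroupOf] at hc ⊢
    have : (w : D) * c * (w : D)⁻¹ = c := by
      rw [hWcomm w w.2 c hc, mul_inv_cancel_right]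
    simpa [this] using hc
  haveI : CompactSpace W := compactSpace_of_isOpen hWo
  have hCWc : IsClosed ((C.subgroupOf W : Subgroup W) : Set W) := by
    rw [Subgroup.coe_subgroupOf]
    exact hCc.preimage continuous_subtype_val
  haveI : IsClosed ((C.subgroupOf W : Subgroup W) : Set W) := hCWc
  haveI : TotallyDisconnectedSpace (W ⧸ C.subgroupOf W) := totallyDisconnectedSpace_quotient _ hCWc
  set ρ : W →* W ⧸ C.subgroupOf W := QuotientGroup.mk' (C.subgroupOf W) with hρ
  have hρC : ∀ (w : D) (hw : w ∈ W), w ∈ C → ρ ⟨w, hw⟩ = 1 := fun w hw hwC => by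
    rw [hρ, QuotientGroup.mk'_apply, QuotientGroup.eq_one_iff, Subgroup.mem_subgroupOf]; exact hwC
  have hR : IsProSigma Sigma (W ⧸ C.subgroupOf W) := by
    let θ₀ : Ubar →* W ⧸ C.subgroupOf W := ρ.comp (Subgroup.inclusion (le_sup_left : Ubar ≤ W))
    have hθc : Continuous θ₀ := by
      refine QuotientGroup.continuous_mk.comp ?_
      rw [continuous_induced_rng]
      exact continuous_subtype_val
    have hθs : Function.Surjective θ₀ := by
      intro r
      obtain ⟨⟨w, hw⟩, rfl⟩ := QuotientGroup.mk'_surjective (C.subgroupOf W) r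
      obtain ⟨a, ha, c, hc, rfl⟩ := hWdec w hw
      refine ⟨⟨a, ha⟩, ?_⟩
      have hprod : (⟨a * c, hw⟩ : W) = ⟨a, le_sup_left (a := Ubar) ha⟩ * ⟨c, hCW hc⟩ := rfl
      change ρ ⟨a, _⟩ = ρ ⟨a * c, hw⟩
      rw [hprod, map_mul, hρC c (hCW hc) hc, mul_one]
    exact hmax.proSigma.of_surjective θ₀ hθc hθs
  -- CLAIM C: `K_Σ(U′) = ker f″` maps into `C` under `π` (maximality against `U′ → W → W/C`)
  let φ : U' →* W ⧸ C.subgroupOf W := ρ.comp (π.subgroupComap W)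
  have hφc : Continuous φ := by
    refine QuotientGroup.continuous_mk.comp ?_
    rw [continuous_induced_rng]
    exact hπc.comp continuous_subtype_val
  have hC' : ∀ (k : P) (hk : k ∈ U'), f'' ⟨k, hk⟩ = 1 → π k ∈ C := by
    intro k hk h1
    have hmem : (⟨k, hk⟩ : U') ∈ φ.ker :=
      ker_le_ker_of_isMaxProSigmaQuotient hf'' hR φ hφc (by rw [MonoidHom.mem_ker]; exact h1)
    rw [MonoidHom.mem_ker] at hmem
    change ρ ⟨π k, _⟩ = 1 at hmem
    rw [hρ, QuotientGroup.mk'_apply, QuotientGroup.eq_one_iff, Subgroup.mem_subgroupOf] at hmem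
    exact hmem
  -- CLAIM D: the restriction `ψ : U ↠ Q″` ALSO presents the maximal pro-`Σ` quotient of `U`
  let ψ : U →* U' ⧸ K'' := f''.comp (Subgroup.inclusion hUU')
  have hψ : IsMaxProSigmaQuotient Sigma ψ := by
    refine ⟨?_, ?_, hf''.proSigma, ?_⟩
    · refine hf''.continuous.comp ?_
      rw [continuous_induced_rng]
      exact continuous_subtype_val
    · intro q
      obtain ⟨⟨y, hy⟩, rfl⟩ := QuotientGroup.mk'_surjective K'' q
      obtain ⟨a, ha, c, hc, hac⟩ := hWdec (π y) (Subgroup.mem_comap.mp hy)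
      obtain ⟨u, hu, rfl⟩ := Subgroup.mem_map.mp ha
      have hz : u⁻¹ * y ∈ U' := U'.mul_mem (U'.inv_mem (hUU' hu)) hy
      have hzC : π (u⁻¹ * y) ∈ C := by
        rw [map_mul, map_inv, ← hac, inv_mul_cancel_left]; exact hc
      have h1 := hB _ hz hzC
      refine ⟨⟨u, hu⟩, ?_⟩
      have hprod : (⟨y, hy⟩ : U') = ⟨u, hUU' hu⟩ * ⟨u⁻¹ * y, hz⟩ := Subtype.ext (by simp)
      change f'' ⟨u, hUU' hu⟩ = f'' ⟨y, hy⟩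
      rw [hprod, map_mul, h1, mul_one]
    · intro N hNn hNo hNS
      refine le_trans (fun x hx => ?_) (hmax.ker_le N hNn hNo hNS)
      obtain ⟨k, hk⟩ := x
      rw [MonoidHom.mem_ker] at hx ⊢
      have hπk : π k ∈ C := hC' k (hUU' hk) hx
      have hπk1 : π k = 1 := hCU _ hπk (Subgroup.mem_map_of_mem π hk)
      exact Subtype.ext (by simp [hπk1])
  -- hence `Q″` is a pro-`Σ` completion of BOTH `j⁻¹U` and `j⁻¹U′`: (RIGID) gives `j⁻¹U′ ≤ j⁻¹U`
  have hιψ : IsProSigmaCompletion Sigma (ψ.comp (j.subgroupComap U)) :=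
    comp_isMaxProSigmaQuotient hSS (hj.restrict U hUo) hψ
  have heqhom : (f''.comp (j.subgroupComap U')).comp (Subgroup.inclusion (Subgroup.comap_mono hUU')) =
      ψ.comp (j.subgroupComap U) := MonoidHom.ext fun _ => rfl
  have hιψ' : IsProSigmaCompletion Sigma
      ((f''.comp (j.subgroupComap U')).comp (Subgroup.inclusion (Subgroup.comap_mono hUU'))) := by
    rw [heqhom]; exact hιψ
  have hle' : U'.comap j ≤ U.comap j := hrigid U' hU'o hUU' _ hι'' hιψ'
  have hcomap : U'.comap j = U.comap j := le_antisymm hle' (Subgroup.comap_mono hUU')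
  -- so `[P : U] = [P : U′]`, `U′ = U`, and `δ ∈ π(U′) = π(U)`: contradiction
  have hidx : U.index = U'.index := by rw [← hidxU, ← hidxU', hcomap]
  have hle : U' ≤ U := by
    have hmul := Subgroup.relIndex_mul_index hUU'
    rw [hidx] at hmul
    haveI : U'.FiniteIndex := Subgroup.finiteIndex_of_le hUU'
    have hrel : U.relIndex U' = 1 := by
      have hne : U'.index ≠ 0 := Subgroup.FiniteIndex.index_ne_zero
      exact (mul_eq_right₀ hne).mp hmul
    exact Subgroup.relIndex_eq_one.mp hrel
  obtain ⟨x, hx⟩ := hπs δ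
  have hxU' : x ∈ U' := Subgroup.mem_comap.mpr (by rw [hx]; exact hδW)
  exact hδU (by rw [← hx]; exact Subgroup.mem_map_of_mem π (hle hxU'))

/-- The engine in OUTER-FAITHFULNESS form: under (SLIM) + (RIGID), an element of `D` acting on `π(U)` as an
inner automorphism of `π(U)` lies in `π(U)` — the hypothesis shape `hOut` consumed by
`slim_and_elastic_of_isOpen_proSigma_hyperbolic_of_outerFaithful'` (abc-iut-w6-d071, p437786).
[cite: MochizukiAbsTopI2012, Prop 2.3 (i) p.19] -/
theorem mem_map_of_conj_eq_conj_of_slim_of_rigid (hSS : Sigma ⊆ Sigma')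
    (hj : IsProSigmaCompletion Sigma' j) [hUn : U.Normal] (hUo : IsOpen (U : Set P))
    (hπc : Continuous π) (hπs : Function.Surjective π) (hker : π.ker ≤ U)
    (hmax : IsMaxProSigmaQuotient Sigma (π.subgroupMap U))
    (hslim : ∀ (V : Subgroup P), IsOpen (V : Set P) → U ≤ V →
      ∀ {Q : Type u} [Group Q] [TopologicalSpace Q] [IsTopologicalGroup Q] [CompactSpace Q] [T2Space Q]
        [TotallyDisconnectedSpace Q] (φ : V.comap j →* Q), IsProSigmaCompletion Sigma φ → IsSlimGroup Q)
    (hrigid : ∀ (V : Subgroup P), IsOpen (V : Set P) → (hUV : U ≤ V) →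
      ∀ {Q : Type u} [Group Q] [TopologicalSpace Q] [IsTopologicalGroup Q] [CompactSpace Q] [T2Space Q]
        [TotallyDisconnectedSpace Q] (φ : V.comap j →* Q), IsProSigmaCompletion Sigma φ →
        IsProSigmaCompletion Sigma (φ.comp (Subgroup.inclusion (Subgroup.comap_mono hUV))) →
        V.comap j ≤ U.comap j) :
    ∀ x : D, (∃ u ∈ U.map π, ∀ y ∈ U.map π, x * y * x⁻¹ = u * y * u⁻¹) → x ∈ U.map π := by
  have hZ := centralizer_map_eq_bot_of_slim_of_rigid hSS hj hUo hπc hπs hker hmax hslim hrigid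
  intro x ⟨u, hu, hconj⟩
  -- `u⁻¹ x` centralises `π(U)`, hence is trivial
  have hmem : u⁻¹ * x ∈ Subgroup.centralizer ((U.map π : Subgroup D) : Set D) := by
    rw [Subgroup.mem_centralizer_iff]
    intro y hy
    have h := hconj y hy
    -- `x y x⁻¹ = u y u⁻¹` ⇒ `y (u⁻¹ x) = (u⁻¹ x) y`
    calc y * (u⁻¹ * x) = u⁻¹ * (u * y * u⁻¹) * x := by group
      _ = u⁻¹ * (x * y * x⁻¹) * x := by rw [h]
      _ = u⁻¹ * x * y := by group
  rw [hZ, Subgroup.mem_bot] at hmem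
  have hx : x = u := by
    have := congrArg (u * ·) hmem
    simpa using this
  rw [hx]; exact hu

end GFGSurfaceModel

end Literature.AnabelianGeometry.AbsoluteAnabelian

end
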